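import Literature.AnabelianGeometry.SemiGraphs.BTempQDPairHomHat
import Literature.AnabelianGeometry.SemiGraphs.BTempPullbackOrbit
import Literature.AnabelianGeometry.SemiGraphs.QuasiTemperoidsRmkA31Proofs
import HarnessLib

/-!
# Semi-graphs of anabelioids, Appendix, proof of Theorem A.4: every arrow `B/Γ_B → C/Γ_C` is
# realised by a 1-proper cover (row A4-S, realisation half, PROVED for `B^temp(Π)`)

Mochizuki, *Semi-graphs of anabelioids*, Publ. RIMS **42** (2006) 221–322, Appendix, proof of
Theorem A.4, manuscript pp. 83–84 (PRIMS p. 313 ll. 23–28)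
[cite: MochizukiSemiAnbd2006, Thm A.4 proof pp.83-84]: "one verifies immediately that every element
of `Hom_{T_i}(B/Γ_B, C/Γ_C)` arises from some morphism of strongly connected QD-pairs
`(B′, Γ_B′) → (C, Γ_C)` where `(B′, Γ_B′) → (B, Γ_B)` is a 1-proper morphism of strongly connected
QD-pairs [so we obtain a morphism `B/Γ_B → C/Γ_C` by composing the induced morphism
`B′/Γ_B′ → C/Γ_C` with the inverse of the induced isomorphism `B′/Γ_B′ ⥲ B/Γ_B`]."

This file PROVES that sentence for the model temperoid `T = B^temp(Π)` (`Π` tempered), i.e. the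
named statement `QDPair.HomHatRealised P C` of `BTempQDPairHomHat.lean` for `(B, Γ_B)` strongly
connected (row A4-S, realisation half, of `plan/L3/SUBDAG-SemiAnbd-Cor311.md`).  The cover is the
one the text leaves implicit: given `u : B/Γ_B → C/Γ_C`, let `W := B ×_{C/Γ_C} C` (fibre product of
`B → B/Γ_B → C/Γ_C` and `C → C/Γ_C`), `B′ :=` the connected component (= `Π`-orbit) of a point
`(b, c)` of `W`, and `Γ_B′ :=` the automorphisms `γ × δ` (`γ ∈ Γ_B`, `δ ∈ Γ_C`) of `W` that stabilise
`B′`, restricted to `B′`: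

* `QDPair.Realise.liftAut` — `(γ, δ) ↦ γ × δ : Γ_B × Γ_C → Aut(W)`; `Realise.cover u hP : OneProperCover P`
  with source `(B′, Γ_B′)`, arrow `B′ ⊆ W → B`; it is 1-PROPER: 0-proper because `B′ → B` is
  surjective (`B` is one orbit; Rmk. A.3.1 (a)⇔(b), `rmkA31_holds`, and `BTemp.epi_iff_surjective`),
  every `γ ∈ Γ_B` lifts (move the base point by `Π`, then correct the `C`-coordinate inside its
  `Γ_C`-orbit = fibre of `C → C/Γ_C`, `QDPair.orbitMk_eq_iff`), and `B′ → B` forms a quotient of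
  `(B′, Ker)` by the criterion `QDPair.isQuotient_iff_surjective` (two points of `B′` over the same
  `b` differ by `1 × δ`);
* `Realise.toC u hP : (cover).src ⟶ C` — `B′ ⊆ W → C`;
* **`QDPair.homHatRealised_of_isStronglyConnected`**: `(q(B′ → B))⁻¹ ≫ q(B′ → C) = u`, hence
  `HomHatRealised P C`; with `homHatToHom_surjective_of_realised`, the comparison map
  `Hom^ → Hom_T(B/Γ_B, C/Γ_C)` is SURJECTIVE for strongly connected `(B, Γ_B)`.

Elementary `Π`-set theory; nothing refers to the IUT corpus; no side is taken on any disputed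
claim.
-/

open CategoryTheory

namespace Literature.AnabelianGeometry.SemiGraphs

open Literature.AlgebraicGeometry.Frobenioids (IsConnectedObj)
open Literature.AlgebraicGeometry.Frobenioids.QuasiTemperoid.BTempConnected (hom_ρ hom_ext_apply
  ρ_one_apply ρ_mul_apply ρ_inv_apply ρ_apply_inv nonempty_of_isConnectedObj
  exists_ρ_eq_of_isConnectedObj)

universe u

namespace QDPair

namespace Realise

variable {G : Type u} [Group G] [TopologicalSpace G] [IsTopologicalGroup G]
  {P C : QDPair (BTemp G)} (u : P.orbitQuotient ⟶ C.orbitQuotient)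

/-! ### The fibre product `W = B ×_{C/Γ_C} C` and the automorphisms `γ × δ` -/

/-- `W := B ×_{C/Γ_C} C`, the fibre product of `B → B/Γ_B → C/Γ_C` (via `u`) and `C → C/Γ_C`.
[cite: MochizukiSemiAnbd2006, Thm A.4 proof pp.83-84] -/
abbrev W : BTemp G := BTemp.pullbackObj (P.orbitQuotientπ ≫ u) C.orbitQuotientπ

/-- Elements of `Γ_B` lie over `C/Γ_C`. [cite: MochizukiSemiAnbd2006, Thm A.4 proof pp.83-84] -/
theorem aut_comp_fst_map {γ : Aut P.A} (hγ : γ ∈ P.Γ) :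
    γ.hom ≫ (P.orbitQuotientπ ≫ u) = P.orbitQuotientπ ≫ u := by
  rw [← Category.assoc, P.aut_comp_orbitQuotientπ hγ]

/-- **`(γ, δ) ↦ γ × δ`**: the automorphisms of `W` induced by `Γ_B × Γ_C`.
[cite: MochizukiSemiAnbd2006, Thm A.4 proof pp.83-84] -/
noncomputable def liftAut : ↥(P.Γ.prod C.Γ) →* Aut (W u) where
  toFun s := BTemp.pullbackAut _ _ s.1.1 s.1.2 (aut_comp_fst_map u s.2.1)
    (C.aut_comp_orbitQuotientπ s.2.2)
  map_one' := Iso.ext (hom_ext_apply fun _ => rfl)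
  map_mul' _ _ := Iso.ext (hom_ext_apply fun _ => rfl)

/-- `γ × δ` on points. [cite: MochizukiSemiAnbd2006, Thm A.4 proof pp.83-84] -/
@[simp] theorem liftAut_apply_val (s : ↥(P.Γ.prod C.Γ)) (p : (W u).obj.V) :
    ((liftAut u s).hom.hom.hom p).1 = (s.1.1.hom.hom.hom p.1.1, s.1.2.hom.hom.hom p.1.2) := rfl

/-- A base point `b ∈ B` (`B` is connected, hence nonempty). [cite: MochizukiSemiAnbd2006, Thm A.4 proof pp.83-84] -/
noncomputable def basePt (hP : P.IsStronglyConnected) : P.A.obj.V := (nonempty_of_isConnectedObj P.A hP).some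

/-- A point `c ∈ C` over `u([b])`. [cite: MochizukiSemiAnbd2006, Thm A.4 proof pp.83-84] -/
noncomputable def fibrePt (hP : P.IsStronglyConnected) : C.A.obj.V :=
  (C.orbitMk_surjective (u.hom.hom (P.orbitMk (basePt hP)))).choose

/-- `[c] = u([b])`. [cite: MochizukiSemiAnbd2006, Thm A.4 proof pp.83-84] -/
theorem fibrePt_spec (hP : P.IsStronglyConnected) :
    C.orbitMk (fibrePt u hP) = (u.hom.hom (P.orbitMk (basePt hP)) : C.orbitQuotient.obj.V) :=
  (C.orbitMk_surjective (u.hom.hom (P.orbitMk (basePt hP)))).choose_spec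

/-- The point `w = (b, c) ∈ W`. [cite: MochizukiSemiAnbd2006, Thm A.4 proof pp.83-84] -/
noncomputable def w (hP : P.IsStronglyConnected) : (W u).obj.V :=
  BTemp.pullbackPt _ _ (basePt hP) (fibrePt u hP) (fibrePt_spec u hP).symm

/-- `B′ :=` the connected component (`Π`-orbit) of `w` in `W`. [cite: MochizukiSemiAnbd2006, Thm A.4 proof p.84] -/
@[reducible] noncomputable def B' (hP : P.IsStronglyConnected) : BTemp G := BTemp.orbitObj (W u) (w u hP)

/-- `Γ_B′ ≤ Aut(B′)`: the `γ × δ` stabilising `B′`, restricted to `B′`.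
[cite: MochizukiSemiAnbd2006, Thm A.4 proof p.84] -/
noncomputable def ΓB' (hP : P.IsStronglyConnected) : Subgroup (Aut (B' u hP)) :=
  ((liftAut u).range.subgroupOf (BTemp.stabOrbit (W u) (w u hP))).map
    (BTemp.restrictOrbit (W u) (w u hP))

/-- Membership in `Γ_B′`: restrictions of orbit-stabilising `γ × δ`.
[cite: MochizukiSemiAnbd2006, Thm A.4 proof p.84] -/
theorem mem_ΓB'_iff (hP : P.IsStronglyConnected) (ε : Aut (B' u hP)) :
    ε ∈ ΓB' u hP ↔ ∃ (σ : BTemp.stabOrbit (W u) (w u hP)) (s : ↥(P.Γ.prod C.Γ)),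
      liftAut u s = σ.1 ∧ BTemp.restrictOrbit (W u) (w u hP) σ = ε := by
  constructor
  · rintro ⟨σ, ⟨s, hs⟩, rfl⟩
    exact ⟨σ, s, hs, rfl⟩
  · rintro ⟨σ, s, hs, rfl⟩
    exact ⟨σ, ⟨s, hs⟩, rfl⟩

/-- The restriction of an orbit-stabilising `γ × δ` lies in `Γ_B′`.
[cite: MochizukiSemiAnbd2006, Thm A.4 proof p.84] -/
theorem restrict_mem_ΓB' (hP : P.IsStronglyConnected) (s : ↥(P.Γ.prod C.Γ))
    (hs : liftAut u s ∈ BTemp.stabOrbit (W u) (w u hP)) :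
    BTemp.restrictOrbit (W u) (w u hP) ⟨liftAut u s, hs⟩ ∈ ΓB' u hP :=
  (mem_ΓB'_iff u hP _).mpr ⟨⟨liftAut u s, hs⟩, s, rfl, rfl⟩

/-- The source `(B′, Γ_B′)` of the cover. [cite: MochizukiSemiAnbd2006, Thm A.4 proof p.84] -/
noncomputable def src (hP : P.IsStronglyConnected) : QDPair (BTemp G) := ⟨B' u hP, ΓB' u hP⟩

/-- The arrow `B′ ⊆ W → B` as a morphism of QD-pairs `(B′, Γ_B′) → (B, Γ_B)` (`γ × δ ↦ γ`).
[cite: MochizukiSemiAnbd2006, Thm A.4 proof pp.83-84] -/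
noncomputable def toB (hP : P.IsStronglyConnected) : src u hP ⟶ P where
  hom := BTemp.orbitIncl (W u) (w u hP) ≫ BTemp.pullbackFst _ _
  comm := by
    intro ε hε
    obtain ⟨σ, s, hs, rfl⟩ := (mem_ΓB'_iff u hP ε).mp hε
    refine ⟨s.1.1, s.2.1, hom_ext_apply fun y => ?_⟩
    change (s.1.1.hom.hom.hom y.1.1.1 : P.A.obj.V) = (σ.1.hom.hom.hom y.1).1.1
    rw [← hs]
    rfl

/-- The arrow `B′ ⊆ W → C` as a morphism of QD-pairs `(B′, Γ_B′) → (C, Γ_C)` (`γ × δ ↦ δ`).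
[cite: MochizukiSemiAnbd2006, Thm A.4 proof pp.83-84] -/
noncomputable def toC (hP : P.IsStronglyConnected) : src u hP ⟶ C where
  hom := BTemp.orbitIncl (W u) (w u hP) ≫ BTemp.pullbackSnd _ _
  comm := by
    intro ε hε
    obtain ⟨σ, s, hs, rfl⟩ := (mem_ΓB'_iff u hP ε).mp hε
    refine ⟨s.1.2, s.2.2, hom_ext_apply fun y => ?_⟩
    change (s.1.2.hom.hom.hom y.1.1.2 : C.A.obj.V) = (σ.1.hom.hom.hom y.1).1.2
    rw [← hs]
    rfl

/-- `B′ → B` on points: the first coordinate. [cite: MochizukiSemiAnbd2006, Thm A.4 proof pp.83-84] -/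
@[simp] theorem toB_apply (hP : P.IsStronglyConnected) (y : (B' u hP).obj.V) :
    ((toB u hP).hom.hom.hom y : P.A.obj.V) = y.1.1.1 := rfl

/-- `B′ → C` on points: the second coordinate. [cite: MochizukiSemiAnbd2006, Thm A.4 proof pp.83-84] -/
@[simp] theorem toC_apply (hP : P.IsStronglyConnected) (y : (B' u hP).obj.V) :
    ((toC u hP).hom.hom.hom y : C.A.obj.V) = y.1.1.2 := rfl

/-! ### `B′ → B` is 1-proper -/

/-- `B′ → B` is surjective (`B` is a single `Π`-orbit). [cite: MochizukiSemiAnbd2006, Thm A.4 proof pp.83-84] -/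
theorem toB_surjective (hP : P.IsStronglyConnected) :
    Function.Surjective fun y : (B' u hP).obj.V => ((toB u hP).hom.hom.hom y : P.A.obj.V) := by
  intro b
  obtain ⟨a, ha⟩ := exists_ρ_eq_of_isConnectedObj P.A hP (basePt hP) b
  exact ⟨(B' u hP).obj.ρ a (BTemp.orbitPt (W u) (w u hP)), ha⟩

/-- Two points of `C` over the same class of `C/Γ_C` differ by an element of `Γ_C` — applied to a
point of `W` moved by `Π`: for `a ∈ Π` there is `δ ∈ Γ_C` with `δ c = a · c` whenever `a · b` and `b`
have the same image… more precisely, whenever `a` fixes `[b] ∈ B/Γ_B` up to `u`.  We only need the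
following form: points `p, p′ ∈ W` with the same first coordinate differ by `1 × δ`, `δ ∈ Γ_C`.
[cite: MochizukiSemiAnbd2006, Thm A.4 proof pp.83-84] -/
theorem exists_delta_of_fst_eq (p p' : (W u).obj.V) (h : p.1.1 = p'.1.1) :
    ∃ δ ∈ C.Γ, (δ.hom.hom.hom p.1.2 : C.A.obj.V) = p'.1.2 := by
  apply C.orbitMk_eq_iff.mp
  have h1 := p.2
  have h2 := p'.2
  -- both second coordinates map to `u [p.1.1] = u [p'.1.1]`
  change (u.hom.hom (P.orbitMk p.1.1) : C.orbitQuotient.obj.V) = C.orbitMk p.1.2 at h1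
  change (u.hom.hom (P.orbitMk p'.1.1) : C.orbitQuotient.obj.V) = C.orbitMk p'.1.2 at h2
  rw [← h1, ← h2, h]

/-- `1 × δ` (`δ ∈ Γ_C`) stabilises `B′` as soon as it maps ONE point of `B′` into `B′`.
[cite: MochizukiSemiAnbd2006, Thm A.4 proof p.84] -/
theorem liftAut_mem_stabOrbit_of_apply_mem (hP : P.IsStronglyConnected) (s : ↥(P.Γ.prod C.Γ)) (y y' : (B' u hP).obj.V)
    (h : ((liftAut u s).hom.hom.hom y.1 : (W u).obj.V) = y'.1) :
    liftAut u s ∈ BTemp.stabOrbit (W u) (w u hP) := by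
  obtain ⟨a, ha⟩ := y.2
  obtain ⟨a', ha'⟩ := y'.2
  -- `σ w = σ (a⁻¹ · y) = a⁻¹ · σ y = a⁻¹ · y' = (a⁻¹ a') · w`
  refine ⟨a⁻¹ * a', ?_⟩
  rw [ρ_mul_apply, ha', ← h, ← hom_ρ, ← ha, ρ_inv_apply]

/-- **Lifting**: every `γ ∈ Γ_B` lifts to `Γ_B′` along `B′ → B` (choose `a ∈ Π` with `γ b = a · b`,
then `δ ∈ Γ_C` with `δ c = a · c`; `γ × δ` maps `w` to `a · w ∈ B′`).
[cite: MochizukiSemiAnbd2006, Thm A.4 proof pp.83-84] -/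
theorem exists_lift (hP : P.IsStronglyConnected) (γ : Aut P.A) (hγ : γ ∈ P.Γ) :
    ∃ ε ∈ (src u hP).Γ, (toB u hP).hom ≫ γ.hom = ε.hom ≫ (toB u hP).hom := by
  -- `γ b = a · b`
  obtain ⟨a, ha⟩ := exists_ρ_eq_of_isConnectedObj P.A hP (basePt hP) (γ.hom.hom.hom (basePt hP))
  -- the point `a · w` and `δ`
  let y' : (B' u hP).obj.V := (B' u hP).obj.ρ a (BTemp.orbitPt (W u) (w u hP))
  obtain ⟨δ, hδ, hδc⟩ := exists_delta_of_fst_eq u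
    ((liftAut u ⟨(γ, 1), hγ, C.Γ.one_mem⟩).hom.hom.hom (w u hP)) y'.1 (by
      change (γ.hom.hom.hom (basePt hP) : P.A.obj.V) = P.A.obj.ρ a (basePt hP)
      exact ha.symm)
  let s : ↥(P.Γ.prod C.Γ) := ⟨(γ, δ), hγ, hδ⟩
  have hs : liftAut u s ∈ BTemp.stabOrbit (W u) (w u hP) :=
    liftAut_mem_stabOrbit_of_apply_mem u hP s (BTemp.orbitPt (W u) (w u hP)) y'
      (BTemp.pullbackObj_ext _ _ (by
        change (γ.hom.hom.hom (basePt hP) : P.A.obj.V) = P.A.obj.ρ a (basePt hP)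
        exact ha.symm) hδc)
  refine ⟨BTemp.restrictOrbit (W u) (w u hP) ⟨liftAut u s, hs⟩, restrict_mem_ΓB' u hP s hs,
    hom_ext_apply fun _ => rfl⟩

/-- **The quotient clause**: `B′ → B` forms a quotient of `(B′, Ker(Γ_B′ → Γ_B))` (the stabiliser of
the arrow), by the criterion — two points of `B′` over the same `b` differ by `1 × δ`, `δ ∈ Γ_C`,
which stabilises `B′` and fixes `B′ → B`. [cite: MochizukiSemiAnbd2006, Thm A.4 proof pp.83-84] -/
theorem isQuotient_stabilizer (hP : P.IsStronglyConnected) :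
    (⟨(src u hP).A, Hom.stabilizer (toB u hP)⟩ : QDPair (BTemp G)).IsQuotient (toB u hP).hom := by
  refine (QDPair.isQuotient_iff_surjective (P := (⟨(src u hP).A, Hom.stabilizer (toB u hP)⟩ :
    QDPair (BTemp G))) (toB u hP).hom).mpr ⟨fun ε hε => hε.2, toB_surjective u hP, ?_⟩
  intro y y' hyy'
  obtain ⟨δ, hδ, hδy⟩ := exists_delta_of_fst_eq u y.1 y'.1 hyy'
  let s : ↥(P.Γ.prod C.Γ) := ⟨(1, δ), P.Γ.one_mem, hδ⟩
  have hsy : ((liftAut u s).hom.hom.hom y.1 : (W u).obj.V) = y'.1 :=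
    BTemp.pullbackObj_ext _ _ hyy' hδy
  have hs : liftAut u s ∈ BTemp.stabOrbit (W u) (w u hP) :=
    liftAut_mem_stabOrbit_of_apply_mem u hP s y y' hsy
  refine ⟨BTemp.restrictOrbit (W u) (w u hP) ⟨liftAut u s, hs⟩,
    ⟨restrict_mem_ΓB' u hP s hs, hom_ext_apply fun _ => rfl⟩, Subtype.ext hsy⟩

/-- **`B′ → B` is 1-proper** (`Π` tempered: 0-properness = epimorphism = surjectivity by Rmk. A.3.1
in the connected quasi-temperoid `B^temp(Π)`). [cite: MochizukiSemiAnbd2006, Thm A.4 proof pp.83-84] -/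
theorem isOneProper_toB (hP : P.IsStronglyConnected) (hG : IsTempered G) : Hom.IsOneProper (toB u hP) := by
  refine ⟨?_, exists_lift u hP, isQuotient_stabilizer u hP⟩
  have h31 := (rmkA31_holds.{u, u, u + 1} (BTemp G) (isConnectedQuasiTemperoid_bTemp hG)
    (src u hP) P (toB u hP)).1
  exact h31.mpr ((BTemp.epi_iff_surjective _).mpr (toB_surjective u hP))

/-- **The 1-proper cover `(B′, Γ_B′) → (B, Γ_B)`** attached to `u`. [cite: MochizukiSemiAnbd2006, Thm A.4 proof pp.83-84] -/
noncomputable def cover (hP : P.IsStronglyConnected) (hG : IsTempered G) : OneProperCover P where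
  src := src u hP
  hom := toB u hP
  isStronglyConnected := BTemp.orbitObj_isConnectedObj (W u) (w u hP)
  isOneProper := isOneProper_toB u hP hG

/-! ### The cover realises `u` -/

/-- `q(B′ → C) = q(B′ → B) ≫ u` (on points: `[(b₁, c₁)] ↦ [c₁] = u [b₁]` by the fibre-product
condition). [cite: MochizukiSemiAnbd2006, Thm A.4 proof pp.83-84] -/
theorem orbitQuotientMap_toC (hP : P.IsStronglyConnected) :
    orbitQuotientMap (toC u hP) = orbitQuotientMap (toB u hP) ≫ u := by
  apply (src u hP).orbitQuotient_hom_ext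
  rw [orbitQuotientπ_map, ← Category.assoc, orbitQuotientπ_map, Category.assoc]
  exact hom_ext_apply fun y => y.1.2.symm

/-- **Row A4-S, realisation half, PROVED for `B^temp(Π)`**: for `(B, Γ_B)` strongly connected and
`Π` tempered, every arrow `u : B/Γ_B → C/Γ_C` is `(q(B′ → B))⁻¹ ≫ q(B′ → C)` for the 1-proper cover
`B′` above — `QDPair.HomHatRealised P C`. [cite: MochizukiSemiAnbd2006, Thm A.4 proof pp.83-84] -/
theorem homHatRealised (hP : P.IsStronglyConnected) (hG : IsTempered G) : HomHatRealised P C := by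
  intro u
  refine ⟨cover u hP hG, toC u hP, ?_⟩
  rw [OneProperCover.toHom_mk]
  haveI := isIso_orbitQuotientMap_of_isOneProper (toB u hP) (isOneProper_toB u hP hG)
  change inv (orbitQuotientMap (toB u hP)) ≫ orbitQuotientMap (toC u hP) = u
  rw [IsIso.inv_comp_eq, orbitQuotientMap_toC]

end Realise

/-- **Row A4-S (realisation) of the sub-DAG, for the model temperoid**: `QDPair.HomHatRealised P C`
holds for every strongly connected `(B, Γ_B)` and every `(C, Γ_C)` of `B^temp(Π)`, `Π` tempered.
[cite: MochizukiSemiAnbd2006, Thm A.4 proof pp.83-84] -/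
theorem homHatRealised_of_isStronglyConnected {G : Type u} [Group G] [TopologicalSpace G]
    [IsTopologicalGroup G] (hG : IsTempered G) {P : QDPair (BTemp G)} (C : QDPair (BTemp G))
    (hP : P.IsStronglyConnected) : HomHatRealised P C :=
  Realise.homHatRealised hP hG

/-- Hence the comparison map `Hom^((B, Γ_B), (C, Γ_C)) → Hom_T(B/Γ_B, C/Γ_C)` is SURJECTIVE for
`(B, Γ_B)` strongly connected. [cite: MochizukiSemiAnbd2006, Thm A.4 proof p.84] -/
theorem homHatToHom_surjective {G : Type u} [Group G] [TopologicalSpace G] [IsTopologicalGroup G]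
    (hG : IsTempered G) {P : QDPair (BTemp G)} (C : QDPair (BTemp G)) (hP : P.IsStronglyConnected) :
    Function.Surjective (homHatToHom P C) :=
  homHatToHom_surjective_of_realised (homHatRealised_of_isStronglyConnected hG C hP)

end QDPair

end Literature.AnabelianGeometry.SemiGraphs
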